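import Summits.HodgeConjecture.HodgeConjecture.Theorems.H413ThetaDistAtLineCCOfCentralType
import Summits.HodgeConjecture.HodgeConjecture.Theorems.H413ThetaDistAtLineArchTypes
import Summits.HodgeConjecture.HodgeConjecture.Theorems.H413CharacterKnobSolve
import Summits.HodgeConjecture.CorCM.B01.Transposition.Item6CentralTypeAtPin
import Literature.NumberTheory.Automorphic.Liu2021.Def411WeilCarriersFrameTransport
import HarnessLib

/-!
# FLOOR-0 P4, S4b — the centre identity (CC₀) for a WEIGHT-ONE conjugate-symplectic `μ` at a `μ`-ADMISSIBLE line
# (closing the archimedean row (A) of F0P4-p01's S4b reduction theorem, modulo the assembler's substitution)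

Cell hodgecm-mathlib (D-0151), FLOOR 0, crux item H413 = stmt-HodgeConjecture-24833; programme P4, line
`Cruxes/H413/Lines/F0_P4AdmissibleOccursInH1.lean` (ED. 3), stub S4b `stub_T3a_holThetaAtAdmissibleLineOfRallisAt`.  Author F0P4-p04 (g2).
`--supports stmt-HodgeConjecture-24833 --as helper`.  KERNEL ONLY: one theorem over LANDED theorems; no `sorry`, no definition.

WHY.  ★ `Theorems/H413ThetaDistAtLineArchTypes` gives the archimedean inputs `harm` ∕ `hdef` of ★ `ThetaJunction.exists_holTheta_atLine_of_inputs` (S4b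
REDUCTION THEOREM, F0P4-p01) for any knob whose slot-`0` character `Ξ` satisfies carch's centre identity (CC₀) `Ξ((t · 1_V)^𝔸) · lineC V a hGR₀ t = 1`; at
F0P4-p01's knob `(η, ν) = (1, χ₀(·,1) · κ⁻¹)` (★ `Theorems/H413CharacterKnobSolve`, SEAT-i MEMO v4 §3) `Ξ = κ := ĉ ∘ adelicInl`, `ĉ` the adelic pair character of the
twist equation `ι_μ = splittingOf hGR₀ ⊗ ĉ` (★ `Theorems/H413OmegaAtLineAdelicTwist` (i)); ★ `Theorems/H413ThetaDistAtLineCCOfCentralType.CC_of_hasCentralTypeAt_twist`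
reduces (CC₀) for `κ` to the CENTRAL TYPE `−𝟙_{w(ι₁)}` of `splittingOf hGR₀ ⊗ ĉ`.  This file discharges that central type from [Liu2021]'s data: by the COR-CM
cell's ★ `CorCM/B01/Transposition/Item6CentralTypeAtPin.hasCentralTypeAt_chiSplittingLine_toHeckeCharacter` the `μ`-splitting `ι_μ = chiSplittingLine (toHecke μ)` of
the line `⟨a⟩` over `V` has central type `∓𝟙_{mk ι₁}` for `μ` conjugate symplectic OF WEIGHT ONE with CM type `Φ_μ = Φ^δ(a)` (the `μ`-ADMISSIBILITY of the line
`a`: `φ ∈ Φ_μ ↔ 0 < Im φ(δ_L · a)`), sign `−` exactly when `(mk ι₁).embedding ∈ Φ_μ` (= the S4b hypothesis `ι₁ ∈ Φ_μ` under the canonical-representative guard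
`(mk ι₁).embedding = ι₁`); ★ `chiSplittingLine_realDiagonal` puts it in the model's W-spelling and ★ `cmPlaceOver_eq_mk` matches `mk ι₁ = w(ι₁)`.

* **`CC_of_weightOne_of_twist_eq`**: for `μ₀` conjugate symplectic of weight one with CM type `Φ`, `φ ∈ Φ ↔ 0 < Im φ(δ_L · a)`, `(mk ι₁).embedding ∈ Φ`, and
  an adelic pair character `ĉ` with `chiSplitting … (vec a) … (toHecke μ₀) = adelicMpCont.twist (splittingOf … hGR) ĉ`:
  `∀ t, ĉ(adelicInl (u_t · 1_V)) · lineC V a hGR t = 1`.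

* §2 AT F0P4-p01's KNOB `(η, ν) = (1, χ₀(·,1) · κ⁻¹)` (★ `Theorems/H413CharacterKnobSolve`, explicit `ν`): `lineCharV_zero … (etaT₀ 1 ν) = κ`
  (`lineCharV_zero_etaT₀_one_knobNu`), and THE ARCHIMEDEAN ROWS (A) OF S4b AS THEOREMS: **`harm_cDiag_of_weightOne`**, **`hdef_cDiag_of_weightOne`** — the
  `harm` ∕ `hdef` binders of ★ `ThetaJunction.exists_holTheta_atLine_of_inputs` at that knob, from: `μ₀` conjugate symplectic of weight one with CM type `Φ_μ`,
  the `μ`-admissibility of the line `a` (`φ ∈ Φ_μ ↔ 0 < Im φ(δ_L · a)`), `(mk ι₁).embedding ∈ Φ_μ`, the canonical-representative guard `hemb`, the positivity `hpos`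
  of the line at `ι₁`, and the twist equation for `ĉ` with `κ := ĉ ∘ adelicInl` continuous.

So the archimedean row (A) of S4b is reduced to the junction's own letters (the twist equation ★ p797879 (i) and the admissibility sign condition).
HC_CM is proved only modulo the printed citations until rung 0 closes.

## References
* [Liu2021] Y. Liu, Camb. J. Math. 9 (2021) = arXiv:2102.11518, Def. 4.1–4.3, Def. 4.12, App. D §D.1 Steps 1–3, Lem. D.2.
* [KonnoKonno2007] Lemma 5.2, Thm. 5.4; [GelbartRogawski1991] §3.1 Prop. 3.1.1, Remark p. 457 L4–13; [HarrisKudlaSweet1996] §1.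
* Tree (all ★): `CorCM/B01/Transposition/Item6CentralTypeAtPin` (`hasCentralTypeAt_chiSplittingLine_toHeckeCharacter`), `Liu2021/Def411WeilCarriersFrameTransport`
  (`chiSplittingLine_realDiagonal`), `Weil1964/ArchDualPairThetaMajorants` (`cmPlaceOver_eq_mk`), `Theorems/H413ThetaDistAtLineCCOfCentralType` (`CC_of_hasCentralTypeAt_twist`).
-/

set_option autoImplicit false
set_option linter.dupNamespace false

noncomputable section

open NumberField hiding relNormOneIdeles relNormOneRat probHaarRelNormOneQuot
open _root_.NumberField.InfinitePlace _root_.NumberField.mixedEmbedding MeasureTheory MulAction IsDedekindDomain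
open scoped Matrix TensorProduct Classical SchwartzMap
open Literature.NumberTheory.Automorphic Literature.NumberTheory.Automorphic.UnitaryGroup Literature.NumberTheory.Weil1964
open Literature.NumberTheory.GelbartRogawski1991 Literature.NumberTheory.GelbartRogawski1991.UnitaryDualPair
open Literature.NumberTheory.GelbartRogawski1991.GRConstruction
open Literature.NumberTheory.Automorphic.Liu2021.Def411WeilCarriersDoubling
open Literature.NumberTheory.Automorphic.IdeleClassGroup
open Literature.NumberTheory.GaloisRepresentations
open Literature.RepresentationTheory.HarrisKudlaSweet1996
open Literature.Geometry.ComplexHyperbolic.BallModel (U21 x₀)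
open Literature.AlgebraicGeometry.ShimuraVarieties Literature.Analysis.SegalBargmann
open HodgeCM HodgeCM.Adelic HodgeCM.PerL34 HodgeCM.Model HodgeCM.Model.HypCensus HodgeCM.Model.ArchSideTerm HodgeCM.Model.LiuIndex

namespace Summit.HodgeConjecture.HodgeConjecture.Cruxes.H413.ThetaDistAtLine

/-! ## §1 (CC₀) for a weight-one `μ` at a `μ`-admissible line -/

section WeightOne

variable {L : CMField} {ι₁ : L →+* ℂ} (V : HermSpace3 L ι₁) (a : RealScalar L)
  (hGR : (cmSplittingDatum (L : Type) e₁ (frameD V) (frameD_real V) (frameD_ne V) (RealScalar.vec a) (RealScalar.vec_real a)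
    (RealScalar.vec_ne a)).CompatibleSplitting)
  (μ₀ : Literature.NumberTheory.Automorphic.IdeleClassGroup (L : Type) →ₜ* Circle) (hμ₀ : IsConjugateSymplectic (L : Type) μ₀)
  (hw : HasWeight (L : Type) μ₀ 1) {Φ : Literature.AlgebraicGeometry.Motives.CMType (L : Type)} (hΦμ : HasCMType (L : Type) μ₀ Φ)
  (hΦ : ∀ φ : (L : Type) →+* ℂ, φ ∈ Φ.1 ↔ 0 < (φ (imagUnit (L : Type) * a.1)).im)
  (hι₁ : (InfinitePlace.mk ι₁).embedding ∈ Φ.1)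
  (ĉ : UnitaryGroup.adelicPair (↥(maximalRealSubfield (L : Type))) (L : Type) (IsCMField.complexConj (L : Type)) 3 1 (Matrix.diagonal (frameD V))
    (Matrix.diagonal (RealScalar.vec a)) →* ℂˣ)
  -- the twist equation `ι_μ = splittingOf hGR ⊗ ĉ` of ★ `Theorems/H413OmegaAtLineAdelicTwist` (i), in the model's W-spelling `diagonal (vec a)`
  (htw : chiSplitting (L : Type) e₁ (frameD V) (frameD_real V) (frameD_ne V) (RealScalar.vec a) (RealScalar.vec_real a) (RealScalar.vec_ne a)
      (toHeckeCharacter (L : Type) μ₀) (isUnitary_toHeckeCharacter (L : Type) μ₀)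
      (isSplittingChar_toHeckeCharacter_of_isConjugateSymplectic (L : Type) μ₀ hμ₀) =
    adelicMpCont.twist (↥(maximalRealSubfield (L : Type))) (Fin 3) _
      (splittingOf (↥(maximalRealSubfield (L : Type))) (L : Type) (IsCMField.complexConj (L : Type)) 3 1 e₁
        (Matrix.diagonal (frameD V)) (Matrix.diagonal (RealScalar.vec a)) (complexConj_imagUnit (L : Type)) (imagUnit_ne_zero (L : Type))
        (imagUnit_mul_self (L : Type)) (realDiagonal_isSymm (L : Type) (frameD V) (frameD_real V))
        (realDiagonal_isSymm (L : Type) (RealScalar.vec a) (RealScalar.vec_real a))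
        (isUnit_det_realDiagonal (L : Type) (frameD V) (frameD_real V) (frameD_ne V))
        (isUnit_det_realDiagonal (L : Type) (RealScalar.vec a) (RealScalar.vec_real a) (RealScalar.vec_ne a))
        (realDiagonal_map (L : Type) (frameD V) (frameD_real V)).symm
        (realDiagonal_map (L : Type) (RealScalar.vec a) (RealScalar.vec_real a)).symm hGR) ĉ)

include hw hΦμ hΦ hι₁ htw in
set_option maxHeartbeats 4000000 in
-- (the COR-CM central-type theorem spells `chiSplittingLine` at the `CMField` pin; one `rw` through that telescope)
/-- **(CC₀) FOR A WEIGHT-ONE `μ` AT A `μ`-ADMISSIBLE LINE, `ι₁ ∈ Φ_μ`.**  See the module docstring: the `V`-part `κ := ĉ ∘ adelicInl` of the twist `ι_μ = s₀ ⊗ ĉ`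
satisfies carch's centre identity `κ(u_t · 1_V) · lineC V a hGR t = 1` — the hypothesis `hCC` of ★ `Theorems/H413ThetaDistAtLineArchTypes` at F0P4-p01's knob.
[cite: Liu2021, Def. 4.12; App. D §D.1 Steps 1–3, Lem. D.2] [cite: KonnoKonno2007, Lemma 5.2, Thm 5.4] [cite: GelbartRogawski1991, §3.1 Prop. 3.1.1, Remark p. 457 L4–13] -/
theorem CC_of_weightOne_of_twist_eq (t : ↥(Literature.NumberTheory.Automorphic.relNormOneInfUnits (↥(maximalRealSubfield L)) L)) :
    ((ĉ (UnitaryGroup.adelicInl (↥(maximalRealSubfield (L : Type))) (L : Type) (IsCMField.complexConj (L : Type)) 3 1 (Matrix.diagonal (frameD V))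
          (Matrix.diagonal (RealScalar.vec a)) (CMCenter (L : Type) (frameD V) (infUnitToOne (L : Type) t))) : ℂˣ) : ℂ) *
      HodgeCM.Model.ArchSideTerm.lineC V a.1 a.2.1 a.2.2 hGR t = 1 := by
  have hct := Summit.HodgeConjecture.CorCM.Transposition.CentralTypeAtPin.hasCentralTypeAt_chiSplittingLine_toHeckeCharacter V a μ₀ hμ₀ hw hΦμ hΦ
  rw [if_pos hι₁, chiSplittingLine_realDiagonal (hdW0 := RealScalar.vec_ne a), htw,
    ← cmPlaceOver_eq_mk (L : Type) (HypCensus.cmPlace (L : Type) ι₁) ι₁ rfl] at hct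
  -- (= ★ `CC_of_hasCentralTypeAt_twist V a hGR ĉ hct t`, unfolded through ★ `CC_of_hasCentralTypeAt_of_center_smul` + ★ `pairRep_twist_apply`)
  exact CC_of_hasCentralTypeAt_of_center_smul V a hGR
    (ĉ.comp (UnitaryGroup.adelicInl (↥(maximalRealSubfield (L : Type))) (L : Type) (IsCMField.complexConj (L : Type)) 3 1 (Matrix.diagonal (frameD V))
      (Matrix.diagonal (RealScalar.vec a)))) _ hct
    (fun t x₀ Nl => by
      rw [Literature.NumberTheory.GelbartRogawski1991.UnitaryDualPair.pairRep_twist_apply,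
        Literature.NumberTheory.GelbartRogawski1991.UnitaryDualPair.pairMap_apply, map_one, mul_one, MonoidHom.comp_apply]) t

end WeightOne

/-! ## §2 At F0P4-p01's knob: the archimedean rows (A) of S4b as theorems -/

section Knob

variable {L : CMField} {ι₁ : L →+* ℂ} (V : HermSpace3 L ι₁)
variable (Φ : Literature.AlgebraicGeometry.Motives.CMType (L : Type)) (σ : (L : Type) →+* ℂ) (a : (L : Type))
  (ha : IsCMField.complexConj (L : Type) a = a) (ha0 : a ≠ 0)
  (κ : CMAdelic (L : Type) (frameD V) →* ℂˣ)

/-- **the slot-`0` character at F0P4-p01's knob is `κ`**: `lineCharV_zero … (etaT₀ 1 (χ₀(·,1) · κ⁻¹)) = κ` (`χ₀` cancels).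
[cite: GelbartRogawski1991, §3.1 Remark p. 457 L4–13] -/
theorem lineCharV_zero_etaT₀_one_knobNu :
    lineCharV_zero V (cDiag Φ σ a ha ha0).D (compat_plane V Φ σ a ha ha0) (compat_line₀ V Φ σ a ha ha0) (compat_line₁ V Φ σ a ha ha0)
        (etaT₀ V (cDiag Φ σ a ha ha0).D (1 : CMAdelic (L : Type) (frameD V) × CMAdelic (L : Type) (dW (cDiag Φ σ a ha ha0).D) →* ℂˣ)
          ((cmLineChar₀ (L : Type) finProdFinEquiv e₁ (frameD V) (frameD_real V) (frameD_ne V) (dW (cDiag Φ σ a ha ha0).D)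
              (dW_real (cDiag Φ σ a ha ha0).D) (dW_ne (cDiag Φ σ a ha ha0).D) (compat_plane V Φ σ a ha ha0) (compat_line₀ V Φ σ a ha ha0)
              (compat_line₁ V Φ σ a ha ha0)).comp (MonoidHom.inl _ _) * κ⁻¹)) = κ := by
  ext v
  rw [lineCharV_zero_apply, etaT₀_apply_mk_one, MonoidHom.one_apply, mul_one, MonoidHom.mul_apply, MonoidHom.inv_apply]
  change (((cmLineChar₀ (L : Type) finProdFinEquiv e₁ (frameD V) (frameD_real V) (frameD_ne V) (dW (cDiag Φ σ a ha ha0).D)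
      (dW_real (cDiag Φ σ a ha ha0).D) (dW_ne (cDiag Φ σ a ha ha0).D) (compat_plane V Φ σ a ha ha0) (compat_line₀ V Φ σ a ha ha0)
      (compat_line₁ V Φ σ a ha ha0) (v, 1) * (κ v)⁻¹)⁻¹ *
    cmLineChar₀ (L : Type) finProdFinEquiv e₁ (frameD V) (frameD_real V) (frameD_ne V) (dW (cDiag Φ σ a ha ha0).D)
      (dW_real (cDiag Φ σ a ha ha0).D) (dW_ne (cDiag Φ σ a ha ha0).D) (compat_plane V Φ σ a ha ha0) (compat_line₀ V Φ σ a ha ha0)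
      (compat_line₁ V Φ σ a ha ha0) (v, 1) : ℂˣ) : ℂ) = _
  rw [ThetaJunction.mul_inv_inv_mul_cancel_aux]

variable (hV : IsAnisotropic L V.Hm)
  (hpos : 0 < cmXW (L : Type) (frameD V) (lineVec (L : Type) (dW (cDiag Φ σ a ha ha0).D 0)) (fun _ => dW_real (cDiag Φ σ a ha ha0).D 0) ι₁
    (HypCensus.cmPlace (L : Type) ι₁) 0)
  (hemb : (InfinitePlace.mk ι₁).embedding = ι₁)
  (hκc : Continuous fun v => ((κ v : ℂˣ) : ℂ))
  (μ₀ : Literature.NumberTheory.Automorphic.IdeleClassGroup (L : Type) →ₜ* Circle) (hμ₀ : IsConjugateSymplectic (L : Type) μ₀)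
  (hw : HasWeight (L : Type) μ₀ 1) {Φμ : Literature.AlgebraicGeometry.Motives.CMType (L : Type)} (hΦμ : HasCMType (L : Type) μ₀ Φμ)
  (hΦ : ∀ φ : (L : Type) →+* ℂ, φ ∈ Φμ.1 ↔ 0 < (φ (imagUnit (L : Type) * a)).im)
  (hι₁ : (InfinitePlace.mk ι₁).embedding ∈ Φμ.1)
  (ĉ : UnitaryGroup.adelicPair (↥(maximalRealSubfield (L : Type))) (L : Type) (IsCMField.complexConj (L : Type)) 3 1 (Matrix.diagonal (frameD V))
    (Matrix.diagonal (lineVec (L : Type) a)) →* ℂˣ)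
  (hκ : κ = ĉ.comp (UnitaryGroup.adelicInl (↥(maximalRealSubfield (L : Type))) (L : Type) (IsCMField.complexConj (L : Type)) 3 1
    (Matrix.diagonal (frameD V)) (Matrix.diagonal (lineVec (L : Type) a))))
  (htw : chiSplitting (L : Type) e₁ (frameD V) (frameD_real V) (frameD_ne V) (lineVec (L : Type) a) (fun _ => ha) (fun _ => ha0)
      (toHeckeCharacter (L : Type) μ₀) (isUnitary_toHeckeCharacter (L : Type) μ₀)
      (isSplittingChar_toHeckeCharacter_of_isConjugateSymplectic (L : Type) μ₀ hμ₀) =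
    adelicMpCont.twist (↥(maximalRealSubfield (L : Type))) (Fin 3) _
      (splittingOf (↥(maximalRealSubfield (L : Type))) (L : Type) (IsCMField.complexConj (L : Type)) 3 1 e₁
        (Matrix.diagonal (frameD V)) (Matrix.diagonal (lineVec (L : Type) a)) (complexConj_imagUnit (L : Type)) (imagUnit_ne_zero (L : Type))
        (imagUnit_mul_self (L : Type)) (realDiagonal_isSymm (L : Type) (frameD V) (frameD_real V))
        (realDiagonal_isSymm (L : Type) (lineVec (L : Type) a) (fun _ => ha))
        (isUnit_det_realDiagonal (L : Type) (frameD V) (frameD_real V) (frameD_ne V))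
        (isUnit_det_realDiagonal (L : Type) (lineVec (L : Type) a) (fun _ => ha) (fun _ => ha0))
        (realDiagonal_map (L : Type) (frameD V) (frameD_real V)).symm
        (realDiagonal_map (L : Type) (lineVec (L : Type) a) (fun _ => ha)).symm (compat_line₀ V Φ σ a ha ha0)) ĉ)

include hw hΦμ hΦ hι₁ hκ htw in
/-- **(CC₀) at F0P4-p01's knob**: the hypothesis `hCC` of ★ `harm_cDiag_of_CC` ∕ `hdef_cDiag_of_CC` for `(η, ν) = (1, χ₀(·,1) · κ⁻¹)`, `κ = ĉ ∘ adelicInl`, from the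
weight-one ∕ admissibility data of `μ` and the twist equation. [cite: Liu2021, Def. 4.12; App. D §D.1 Steps 1–3, Lem. D.2] -/
theorem hCC_knob_of_weightOne (t : ↥(Literature.NumberTheory.Automorphic.relNormOneInfUnits (↥(maximalRealSubfield L)) L)) :
    ((lineCharV_zero V (cDiag Φ σ a ha ha0).D (compat_plane V Φ σ a ha ha0) (compat_line₀ V Φ σ a ha ha0) (compat_line₁ V Φ σ a ha ha0)
          (etaT₀ V (cDiag Φ σ a ha ha0).D (1 : CMAdelic (L : Type) (frameD V) × CMAdelic (L : Type) (dW (cDiag Φ σ a ha ha0).D) →* ℂˣ)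
            ((cmLineChar₀ (L : Type) finProdFinEquiv e₁ (frameD V) (frameD_real V) (frameD_ne V) (dW (cDiag Φ σ a ha ha0).D)
                (dW_real (cDiag Φ σ a ha ha0).D) (dW_ne (cDiag Φ σ a ha ha0).D) (compat_plane V Φ σ a ha ha0) (compat_line₀ V Φ σ a ha ha0)
                (compat_line₁ V Φ σ a ha ha0)).comp (MonoidHom.inl _ _) * κ⁻¹))
          (CMCenter (L : Type) (frameD V) (infUnitToOne (L : Type) t)) : ℂˣ) : ℂ) *
      lineC V a ha ha0 (compat_line₀ V Φ σ a ha ha0) t = 1 := by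
  rw [lineCharV_zero_etaT₀_one_knobNu, hκ]
  exact CC_of_weightOne_of_twist_eq V ⟨a, ha, ha0⟩ (compat_line₀ V Φ σ a ha ha0) μ₀ hμ₀ hw hΦμ hΦ hι₁ ĉ htw t

include hw hΦμ hΦ hι₁ hκ htw hκc hemb in
/-- **THE ARCHIMEDEAN ROW `harm` OF S4b AT F0P4-p01's KNOB IS A THEOREM** (★ `harm_cDiag_of_CC` at `hCC_knob_of_weightOne`; `hηc` = `continuous_one_val`, `hνc` =
`continuous_knobNu`). [cite: Liu2021, App. D Lem. D.2 (2)] [cite: KonnoKonno2007, Thm 5.4] -/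
theorem harm_cDiag_of_weightOne :
    ∀ (u : ↥(stabilizer U21 x₀)) (ℓ : Module.Dual ℂ (Fin 2 → ℂ)),
      lineOmega_zero V (cDiag Φ σ a ha ha0).D (compat_plane V Φ σ a ha ha0) (compat_line₀ V Φ σ a ha ha0) (compat_line₁ V Φ σ a ha ha0)
          (etaT₀ V (cDiag Φ σ a ha ha0).D (1 : CMAdelic (L : Type) (frameD V) × CMAdelic (L : Type) (dW (cDiag Φ σ a ha ha0).D) →* ℂˣ)
            ((cmLineChar₀ (L : Type) finProdFinEquiv e₁ (frameD V) (frameD_real V) (frameD_ne V) (dW (cDiag Φ σ a ha ha0).D)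
                (dW_real (cDiag Φ σ a ha ha0).D) (dW_ne (cDiag Φ σ a ha ha0).D) (compat_plane V Φ σ a ha ha0) (compat_line₀ V Φ σ a ha ha0)
                (compat_line₁ V Φ σ a ha ha0)).comp (MonoidHom.inl _ _) * κ⁻¹)) (u : U21)
          (blockFamilyOfAt (L : Type) e₁ (frameD V) (frameD_real V) (frameD_ne V) (lineVec (L : Type) (dW (cDiag Φ σ a ha ha0).D 0))
            (fun _ => dW_real (cDiag Φ σ a ha ha0).D 0) (fun _ => dW_ne (cDiag Φ σ a ha ha0).D 0) ι₁ (blockPosEquiv V) (blockNegEquiv V)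
            (posIdxEquivUnit hpos) (negIdxEquivEmpty hpos) (degOnePDual Empty) (binvPi 1) ℓ) =
        blockFamilyOfAt (L : Type) e₁ (frameD V) (frameD_real V) (frameD_ne V) (lineVec (L : Type) (dW (cDiag Φ σ a ha ha0).D 0))
          (fun _ => dW_real (cDiag Φ σ a ha ha0).D 0) (fun _ => dW_ne (cDiag Φ σ a ha ha0).D 0) ι₁ (blockPosEquiv V) (blockNegEquiv V)
          (posIdxEquivUnit hpos) (negIdxEquivEmpty hpos) (degOnePDual Empty) (binvPi 1)
          ((BallForms.isPullbackCocycle_cotangentCocycle.weightOf x₀).dual u ℓ) :=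
  harm_cDiag_of_CC V Φ σ a ha ha0 1 (ThetaJunction.continuous_one_val V (cDiag Φ σ a ha ha0)) _
    (ThetaJunction.continuous_knobNu V (cDiag Φ σ a ha ha0) (compat_plane V Φ σ a ha ha0) (compat_line₀ V Φ σ a ha ha0) (compat_line₁ V Φ σ a ha ha0)
      κ hκc (h₁W_cDiag Φ σ a ha ha0)) hpos hemb
    (hCC_knob_of_weightOne V Φ σ a ha ha0 κ μ₀ hμ₀ hw hΦμ hΦ hι₁ ĉ hκ htw)

include hw hΦμ hΦ hι₁ hκ htw hκc in
/-- **THE ARCHIMEDEAN ROW `hdef` OF S4b AT F0P4-p01's KNOB IS A THEOREM** (★ `hdef_cDiag_of_CC` at `hCC_knob_of_weightOne`). [cite: Liu2021, App. D Lem. D.2 (1)] -/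
theorem hdef_cDiag_of_weightOne :
    ∀ g : UnitaryGroup.arch (↥(maximalRealSubfield L)) L (IsCMField.complexConj L) 3 V.Hm,
      UnitaryGroup.archAt (↥(maximalRealSubfield L)) L (IsCMField.complexConj L) 3 V.Hm (UnitaryGroup.cmPlace (L : Type) ι₁)
          (NumberField.complexConj_smul_infinitePlace (L : Type) _) (IsCMField.complexConj_ne_one (L : Type)) g = 1 →
      ∀ (ℓ : Module.Dual ℂ (Fin 2 → ℂ)) (Φf : FinSB (↥(maximalRealSubfield L)) (Fin 3)),
        lineRepOf V (cDiag Φ σ a ha ha0).D (compat_plane V Φ σ a ha ha0) (compat_line₀ V Φ σ a ha ha0) (compat_line₁ V Φ σ a ha ha0)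
            (compat_line₂ V Φ σ a ha ha0) (compat_line₃ V Φ σ a ha ha0)
            (etaT₀ V (cDiag Φ σ a ha ha0).D (1 : CMAdelic (L : Type) (frameD V) × CMAdelic (L : Type) (dW (cDiag Φ σ a ha ha0).D) →* ℂˣ)
              ((cmLineChar₀ (L : Type) finProdFinEquiv e₁ (frameD V) (frameD_real V) (frameD_ne V) (dW (cDiag Φ σ a ha ha0).D)
                  (dW_real (cDiag Φ σ a ha ha0).D) (dW_ne (cDiag Φ σ a ha ha0).D) (compat_plane V Φ σ a ha ha0) (compat_line₀ V Φ σ a ha ha0)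
                  (compat_line₁ V Φ σ a ha ha0)).comp (MonoidHom.inl _ _) * κ⁻¹))
            (etaT₁ V (cDiag Φ σ a ha ha0).D (1 : CMAdelic (L : Type) (frameD V) × CMAdelic (L : Type) (dW (cDiag Φ σ a ha ha0).D) →* ℂˣ)
              ((cmLineChar₀ (L : Type) finProdFinEquiv e₁ (frameD V) (frameD_real V) (frameD_ne V) (dW (cDiag Φ σ a ha ha0).D)
                  (dW_real (cDiag Φ σ a ha ha0).D) (dW_ne (cDiag Φ σ a ha ha0).D) (compat_plane V Φ σ a ha ha0) (compat_line₀ V Φ σ a ha ha0)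
                  (compat_line₁ V Φ σ a ha ha0)).comp (MonoidHom.inl _ _) * κ⁻¹))
            (eta₂ V (cDiag Φ σ a ha ha0).D (1 : CMAdelic (L : Type) (frameD V) × CMAdelic (L : Type) (dW (cDiag Φ σ a ha ha0).D) →* ℂˣ))
            (eta₃ V (cDiag Φ σ a ha ha0).D (1 : CMAdelic (L : Type) (frameD V) × CMAdelic (L : Type) (dW (cDiag Φ σ a ha ha0).D) →* ℂˣ)) 0
            (HodgeCM.Adelic.regimeEquiv L V.Hm hV
              (UnitaryGroup.archToAdelic (↥(maximalRealSubfield L)) L (IsCMField.complexConj L) 3 V.Hm g), 1)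
            (piSchwartzBruhatEquiv (↥(maximalRealSubfield L)) (Fin 3)
              (blockFamilyOfAt (L : Type) e₁ (frameD V) (frameD_real V) (frameD_ne V) (lineVec (L : Type) (dW (cDiag Φ σ a ha ha0).D 0))
                (fun _ => dW_real (cDiag Φ σ a ha ha0).D 0) (fun _ => dW_ne (cDiag Φ σ a ha ha0).D 0) ι₁ (blockPosEquiv V) (blockNegEquiv V)
                (posIdxEquivUnit hpos) (negIdxEquivEmpty hpos) (degOnePDual Empty) (binvPi 1) ℓ ⊗ₜ[ℂ] Φf)) =
          piSchwartzBruhatEquiv (↥(maximalRealSubfield L)) (Fin 3)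
            (blockFamilyOfAt (L : Type) e₁ (frameD V) (frameD_real V) (frameD_ne V) (lineVec (L : Type) (dW (cDiag Φ σ a ha ha0).D 0))
                (fun _ => dW_real (cDiag Φ σ a ha ha0).D 0) (fun _ => dW_ne (cDiag Φ σ a ha ha0).D 0) ι₁ (blockPosEquiv V) (blockNegEquiv V)
                (posIdxEquivUnit hpos) (negIdxEquivEmpty hpos) (degOnePDual Empty) (binvPi 1) ℓ ⊗ₜ[ℂ] Φf) :=
  hdef_cDiag_of_CC V Φ σ a ha ha0 1 (ThetaJunction.continuous_one_val V (cDiag Φ σ a ha ha0)) _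
    (ThetaJunction.continuous_knobNu V (cDiag Φ σ a ha ha0) (compat_plane V Φ σ a ha ha0) (compat_line₀ V Φ σ a ha ha0) (compat_line₁ V Φ σ a ha ha0)
      κ hκc (h₁W_cDiag Φ σ a ha ha0)) hV hpos
    (hCC_knob_of_weightOne V Φ σ a ha ha0 κ μ₀ hμ₀ hw hΦμ hΦ hι₁ ĉ hκ htw)

end Knob

end Summit.HodgeConjecture.HodgeConjecture.Cruxes.H413.ThetaDistAtLine

end
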